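import Mathlib
import Literature.NumberTheory.LFunctions.Zhang2022.SkeletonMeanValue
import Literature.NumberTheory.LFunctions.Zhang2022.SkeletonPartOneB
import Literature.NumberTheory.LFunctions.Zhang2022.Section8MainTerms
import Literature.NumberTheory.LFunctions.Zhang2022.Section8Lemma82
import HarnessLib

/-!
# Zhang (2022), typed skeleton VIII: Part II nodes, continued — Lemmas 8.2–8.4, 10.1–10.2,
# 11.1–11.2, and the section-level deductions of §§8, 9, 10, 11, 18 as named implications

Topic `Literature/NumberTheory/LFunctions/Zhang2022` (Landau–Siegel audit tree; verdict-neutral).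
Y. Zhang, *Discrete mean estimates and the Landau–Siegel zero*, arXiv:2211.02515v1 (2022)
[Zhang2022LandauSiegel] — **an unrefereed manuscript under adjudication; every `def … : Prop` below
is a CLAIM OF THE MANUSCRIPT, STATED NOT ASSERTED.** Besides the lemmas, this file names the
PAGE-LEVEL COMPUTATIONS by which the manuscript turns them into the evaluation nodes of
`SkeletonPropositions` — each as an implication between named nodes (`Ded823`, `Ded97`, `Ded1017`,
`Ded183`, `Ded111`), so that a referee gap inside, e.g., (8.9)–(8.22) has a name — and records
the corresponding modus ponens (`eval823_of`, …), closing the DAG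
`lemmas ⟶ evaluation nodes ⟶ (SkeletonAssembly) ⟶ Theorem 1` in the kernel. One node is
DISCHARGED: `lemma82_holds : 0 ≤ c′ → Lemma82 c′` — **Lemma 8.2 is a theorem of the tree**
(`Lemma82.lemma_8_2`, `Section8Lemma82`; `sum82_eq` matches the two printed forms of the sum).

| node | locator | printed claim |
|---|---|---|
| `Lemma82 c′` (holds, `c′ ≥ 0`) | §8 Lemma 8.2 | `Σ_{m<x} χ(m)m^{−(1−β_j)}(x/m)^{β_μ}log(x/m) = L′(1,χ)𝔣_{jμ}(x) + O(𝓛⁻⁶)` |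
| `Lemma83 c′` | §8 Lemma 8.3 (proof App. A) | `𝔲_j(d,r;s)` analytic for `σ > 9/10`, `≪ ∏(1+cq^{−σ})`, `= Π(d,r) + O(𝓛⁻⁸)` near `1` |
| `Lemma84 c′` | §8 Lemma 8.4 | `Σ_{n<x} χ(n)ξ₀ⱼ(n;d,r)n⁻¹(x/n)^{−β_μ}log(x/n) = L′(1,χ)Π(d,r)𝔤_{jμ}(x) + O(𝓛⁻⁶)` |
| `Lemma101 c′`, `Lemma102 c′` | §10 Lemmas 10.1, 10.2 | (10.2)–(10.5) for `𝔳₁ⱼ(y)`; (10.8)–(10.11) for `𝔳₂ⱼ(d,r)` |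
| `Lemma111`, `Lemma112` | §11 Lemmas 11.1, 11.2 | `f̃(log y/log P) − g̃₁(y)` small; `J̃₁ = Z(s,ψχ)J̃₂(1−s,ψ̄) + O(E₂)` |
| `Ded823 c′`, `Ded97 c′` | §8 pp. 17–18 ((8.9)–(8.22)); §9 ((9.3)–(9.7)) | the computations giving (8.23), (9.7) |
| `Ded1017 c′`, `Ded183 c′` | §10 pp. 20–23 ((10.12)–(10.17)); §18 pp. 36–37 | the computations giving (10.17), the bound behind (2.33) |
| `Ded111 c′` | §11 p. 23 ((11.5)–(11.6), citing "(8.25), (8.26)", which do not exist in v1) | the computation giving (11.1) |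

## References

* Y. Zhang, arXiv:2211.02515v1 (2022), §8 pp. 16–18, §9, §10 pp. 20–23, §11, §18 pp. 36–37,
  Appendix A. [cite: Zhang2022LandauSiegel, §§8–11, 18, App. A]
-/

noncomputable section

open Complex Real ComplexConjugate

namespace Literature.NumberTheory.LFunctions.Zhang2022.Skeleton

section Objects

variable (c' : ℝ) {D : ℕ} [NeZero D] (χ : DirichletCharacter ℂ D)

omit [NeZero D] in
/-- `β_μ` for `μ ∈ {6, 7}` ((2.22); any other index is sent to `β₆`). [cite: Zhang2022LandauSiegel, §2 (2.22)] -/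
def betaMu (D : ℕ) (μ : ℕ) : ℂ := if μ = 7 then beta7 D else beta6 D

omit [NeZero D] in
/-- **`𝔣_{jμ}(x) = (1 + (β_μ − β_j)log x)x^{β_μ}`** (Lemma 8.2; the tree's `frakf`).
[cite: Zhang2022LandauSiegel, §8 Lemma 8.2] -/
def frakfW (D : ℕ) (j μ : ℕ) (y : ℝ) : ℂ := frakf (betaJ c' D j) (betaMu D μ) (Real.log y)

omit [NeZero D] in
/-- **`𝔤_{jμ}(x)`** of Lemma 8.4 (the tree's `frakg` at `β_{j+1}, β_{j+2}, β_μ, log x`).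
[cite: Zhang2022LandauSiegel, §8 Lemma 8.4] -/
def frakgW (D : ℕ) (j μ : ℕ) (y : ℝ) : ℂ :=
  frakg (betaJ c' D (j + 1)) (betaJ c' D (j + 2)) (betaMu D μ) (Real.log y)

/-- **`Π(d,r) = ∏_{q∣dr}(1 − χ(q)q⁻¹)⁻¹ ∏_{(q,r)=1, q∣d} (1 − q⁻¹ − χ(q)q⁻¹)/(1 − q⁻¹)`** (Lemma 8.3).
[cite: Zhang2022LandauSiegel, §8 Lemma 8.3] -/
def PiW (d r : ℕ) : ℂ :=
  (∏ q ∈ (d * r).primeFactors, (1 - χ (q : ZMod D) * (q : ℂ)⁻¹)⁻¹) *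
    ∏ q ∈ d.primeFactors.filter (fun q => Nat.Coprime q r),
      (1 - (q : ℂ)⁻¹ - χ (q : ZMod D) * (q : ℂ)⁻¹) / (1 - (q : ℂ)⁻¹)

/-- The Dirichlet series `Σ_n χ(n)ξ₀ⱼ(n;d,r)n^{−s}` of Lemma 8.3 (absolutely convergent for
`σ > 1`). [cite: Zhang2022LandauSiegel, §8 Lemma 8.3] -/
def xiSeries (j d r : ℕ) (s : ℂ) : ℂ :=
  ∑' n : ℕ, χ (n : ZMod D) * xiZero c' D j n d r * (n : ℂ) ^ (-s)

/-- **`𝔳₁ⱼ(y) = Σ_m χ(m)f̃(log(ym)/log P)m^{−(1−β_j)}`** (Lemma 10.1; finite, `m < P` for `y ≥ 1`).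
[cite: Zhang2022LandauSiegel, §10 Lemma 10.1] -/
def frakv1 (j : ℕ) (y : ℝ) : ℂ :=
  ∑ m ∈ Finset.Ico 1 ⌈bigP D⌉₊, χ (m : ZMod D) *
    (ftilde (Real.log (y * m) / Real.log (bigP D)) : ℂ) / (m : ℂ) ^ (1 - betaJ c' D j)

/-- **`𝔳₂ⱼ(d,r) = Σ_n χ(n)f̃(log(drn)/log P)ξ₀ⱼ(n;d,r)n⁻¹`** (Lemma 10.2; finite, `n < P`).
[cite: Zhang2022LandauSiegel, §10 Lemma 10.2] -/
def frakv2 (j d r : ℕ) : ℂ :=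
  ∑ n ∈ Finset.Ico 1 ⌈bigP D⌉₊, χ (n : ZMod D) *
    (ftilde (Real.log ((d * r * n : ℕ) : ℝ) / Real.log (bigP D)) : ℂ) * xiZero c' D j n d r / (n : ℂ)

omit [NeZero D] in
/-- **`𝔶₁ⱼ(y)`** of (10.9). [cite: Zhang2022LandauSiegel, §10 (10.9)] -/
def fraky1 (D : ℕ) (j : ℕ) (y : ℝ) : ℂ :=
  (betaJ c' D (j + 1) + betaJ c' D (j + 2)) * (Real.log (y / bigP D ^ (0.5 : ℝ)) : ℂ) +
    betaJ c' D (j + 1) * betaJ c' D (j + 2) / 2 *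
      ((Real.log (bigP D ^ (0.504 : ℝ) / y) : ℂ) ^ 2 - 2 * (Real.log (bigP D ^ (0.502 : ℝ) / y) : ℂ) ^ 2)

omit [NeZero D] in
/-- **`𝔶₂ⱼ(y)`** of (10.10). [cite: Zhang2022LandauSiegel, §10 (10.10)] -/
def fraky2 (D : ℕ) (j : ℕ) (y : ℝ) : ℂ :=
  (betaJ c' D (j + 1) + betaJ c' D (j + 2)) * (Real.log (bigP D ^ (0.504 : ℝ) / y) : ℂ) +
    betaJ c' D (j + 1) * betaJ c' D (j + 2) / 2 * (Real.log (bigP D ^ (0.504 : ℝ) / y) : ℂ) ^ 2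

omit [NeZero D] in
/-- `η_± = exp{±𝓛⁻¹⁰}` (§11 p. 23). [cite: Zhang2022LandauSiegel, §11 p. 23] -/
def etaPM (D : ℕ) (sgn : ℝ) : ℝ := Real.exp (sgn * (ell D ^ 10)⁻¹)

omit [NeZero D] in
/-- **`g̃₁(y) = −500∫_{0.5}^{0.502} g(P^z/y)dz + 500∫_{0.502}^{0.504} g(P^z/y)dz`** (§11 p. 23).
Each integral is parenthesised: the interval-integral notation parses its integrand at a precedence
below `+`, so without the parentheses the first integrand would capture the second term (campaign
D-0069 mis-parse report L3-t3/sz-d33, 2026-08-25; fixed in place, the printed meaning).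
[cite: Zhang2022LandauSiegel, §11 p. 23] -/
def gtilde1 (D : ℕ) (y : ℝ) : ℝ :=
  -500 * (∫ z in (0.5 : ℝ)..0.502, gW D (bigP D ^ z / y)) +
    500 * (∫ z in (0.502 : ℝ)..0.504, gW D (bigP D ^ z / y))

omit [NeZero D] in
/-- **`g̃₂(y) = −500∫_{0.496}^{0.498} g(P^zDt₀/y)dz + 500∫_{0.498}^{0.5} g(P^zDt₀/y)dz`** (§11 p. 23)
(each integral parenthesised, as for `gtilde1`). [cite: Zhang2022LandauSiegel, §11 p. 23] -/
def gtilde2 (D : ℕ) (y : ℝ) : ℝ :=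
  -500 * (∫ z in (0.496 : ℝ)..0.498, gW D (bigP D ^ z * D * t0 D / y)) +
    500 * (∫ z in (0.498 : ℝ)..0.5, gW D (bigP D ^ z * D * t0 D / y))

variable (x : Chr D)

/-- **`J̃₁(s,ψ) = Σ_n ψχ(n)g̃₁(n)n^{−s}`** (§11 p. 23; a rapidly convergent series).
[cite: Zhang2022LandauSiegel, §11 p. 23] -/
def Jtilde1 (s : ℂ) : ℂ := ∑' n : ℕ, pc χ x n * (gtilde1 D n : ℂ) * (n : ℂ) ^ (-s)

/-- **`J̃₂(w,ψ̄) = Σ_n conj(ψχ(n))g̃₂(n)n^{−w}`**, used at `w = 1 − s` (§11 p. 23, Lemma 11.2).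
[cite: Zhang2022LandauSiegel, §11 Lemma 11.2] -/
def Jtilde2Bar (w : ℂ) : ℂ := ∑' n : ℕ, conj (pc χ x n) * (gtilde2 D n : ℂ) * (n : ℂ) ^ (-w)

/-- **`E₂(s,ψ) = 𝓛⁻⁶⁸∫_{−𝓛²⁰}^{𝓛²⁰}|Σ_{n<P₁}ψχ(n)n^{−(s+iv)}|ω₁(iv)dv`** (Lemma 11.2, printed
`E(s,ψ)`). [cite: Zhang2022LandauSiegel, §11 Lemma 11.2] -/
def E2main (s : ℂ) : ℝ :=
  (ell D ^ 68)⁻¹ * ∫ v in (-(ell D ^ 20))..(ell D ^ 20),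
    ‖∑ n ∈ Finset.Ico 1 ⌈P1 D⌉₊, pc χ x n * (n : ℂ) ^ (-(s + v * I))‖ *
      Real.exp (-(v ^ 2) / (4 * ell D ^ 30))

end Objects

/-! ## Lemmas 8.2–8.4 -/

section Lemmas

variable (c' : ℝ)

/-- **Lemma 8.2** (§8 p. 17, under (A)): "Suppose `T < x < P`. Then for `μ = 6, 7`,
`Σ_{m<x} χ(m)m^{−(1−β_j)}(x/m)^{β_μ}log(x/m) = L′(1,χ)𝔣_{jμ}(x) + O(𝓛⁻⁶)`." CLAIM.
[cite: Zhang2022LandauSiegel, §8 Lemma 8.2] -/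
def Lemma82 : Prop :=
  ∃ C : ℝ, ForAllLarge fun D _ χ => AssumptionA D χ →
    ∀ j ∈ ({1, 2, 3} : Finset ℕ), ∀ μ ∈ ({6, 7} : Finset ℕ), ∀ y : ℝ, bigT D < y → y < bigP D →
      ‖(∑ m ∈ Finset.Ico 1 ⌈y⌉₊, χ (m : ZMod D) / (m : ℂ) ^ (1 - betaJ c' D j) *
            ((y / m : ℝ) : ℂ) ^ betaMu D μ * (Real.log (y / m) : ℂ)) -
          deriv χ.LFunction 1 * frakfW c' D j μ y‖ ≤ C * (ell D ^ 6)⁻¹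

/-- The two printed forms of the summand of Lemma 8.2 agree, and the sum over `m < x` equals the
sum over `m ≤ x` (the term `m = x`, if any, carries `log(x/m) = 0`).
[cite: Zhang2022LandauSiegel, §8 Lemma 8.2] -/
theorem sum82_eq {D : ℕ} (χ : DirichletCharacter ℂ D) (β γ : ℂ) {y : ℝ} (hy : 0 < y) :
    ∑ m ∈ Finset.Ico 1 ⌈y⌉₊, χ (m : ZMod D) / (m : ℂ) ^ (1 - β) * ((y / m : ℝ) : ℂ) ^ γ *
        (Real.log (y / m) : ℂ) =
      ∑ m ∈ Finset.Ioc 0 ⌊y⌋₊, χ (m : ZMod D) * (m : ℂ) ^ (β - 1) * ((y / m : ℝ) : ℂ) ^ γ *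
        (Real.log (y / m) : ℂ) := by
  have hsub : Finset.Ico 1 ⌈y⌉₊ ⊆ Finset.Ioc 0 ⌊y⌋₊ := by
    intro m hm
    rw [Finset.mem_Ico] at hm
    rw [Finset.mem_Ioc]
    exact ⟨hm.1, Nat.le_floor (Nat.lt_ceil.mp hm.2).le⟩
  have hterm : ∀ m ∈ Finset.Ico 1 ⌈y⌉₊,
      χ (m : ZMod D) / (m : ℂ) ^ (1 - β) * ((y / m : ℝ) : ℂ) ^ γ * (Real.log (y / m) : ℂ) =
        χ (m : ZMod D) * (m : ℂ) ^ (β - 1) * ((y / m : ℝ) : ℂ) ^ γ * (Real.log (y / m) : ℂ) := by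
    intro m _
    rw [div_eq_mul_inv, ← Complex.cpow_neg, neg_sub]
  rw [Finset.sum_congr rfl hterm]
  apply Finset.sum_subset hsub
  intro m hm hm'
  rw [Finset.mem_Ioc] at hm
  rw [Finset.mem_Ico, not_and, not_lt] at hm'
  have hym : y ≤ m := Nat.ceil_le.mp (hm' hm.1)
  have hmy : (m : ℝ) ≤ y := (Nat.le_floor_iff hy.le).mp hm.2
  have hm_eq : (m : ℝ) = y := le_antisymm hmy hym
  have hlog : Real.log (y / m) = 0 := by rw [hm_eq, div_self hy.ne', Real.log_one]
  simp [hlog]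

/-- **Lemma 8.2 is a theorem of the tree** (for `c′ ≥ 0`): the node `Lemma82 c′` HOLDS, by
`Lemma82.lemma_8_2` (`Section8Lemma82`: partial summation against `L(s,χ)` near `s = 1` under (A),
kernel-checked). [cite: Zhang2022LandauSiegel, §8 Lemma 8.2] -/
theorem lemma82_holds {c' : ℝ} (hc' : 0 ≤ c') : Lemma82 c' := by
  obtain ⟨C, h⟩ := Lemma82.lemma_8_2 hc'
  refine ⟨C, ⌈Real.exp (8 * (3 + 5 * c') * π + 3)⌉₊,
    fun D _ χ hD hq hp hA j hj μ hμ y hTy hyP => ?_⟩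
  have hexp : Real.exp (8 * (3 + 5 * c') * π + 3) ≤ D :=
    le_trans (Nat.le_ceil _) (by exact_mod_cast hD)
  have hlog : 8 * (3 + 5 * c') * π + 3 ≤ Real.log D :=
    (Real.le_log_iff_exp_le (lt_of_lt_of_le (Real.exp_pos _) hexp)).mpr hexp
  have hπ0 : 0 ≤ 8 * (3 + 5 * c') * π := by positivity
  have hL3 : 3 ≤ Real.log D := by linarith
  have hL8 : 8 * (3 + 5 * c') * π ≤ Real.log D ^ 8 := by
    have h1 : (1 : ℝ) ≤ Real.log D := by linarith
    calc 8 * (3 + 5 * c') * π ≤ Real.log D := by linarith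
      _ = Real.log D ^ 1 := (pow_one _).symm
      _ ≤ Real.log D ^ 8 := pow_le_pow_right₀ h1 (by norm_num)
  have hA' : ‖χ.LFunction 1‖ ≤ 1 / Real.log D ^ 2022 := le_of_lt hA
  have hα : alpha D = π / Real.log D ^ 9 := by rw [alpha, bigP, Real.log_exp, ell]
  have hβj : betaJ c' D j ∈ ({Lemma82.beta1 c' (Real.log D), Lemma82.beta2 c' (Real.log D),
      Lemma82.beta3 c' (Real.log D)} : Set ℂ) := by
    simp only [Finset.mem_insert, Finset.mem_singleton] at hj
    simp only [Set.mem_insert_iff, Set.mem_singleton_iff]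
    rcases hj with rfl | rfl | rfl
    · left
      simp only [betaJ, Nat.reduceMod, if_true, beta1, Lemma82.beta1, hα, ell]
      push_cast; ring
    · right; left
      simp only [betaJ, Nat.reduceMod, beta2, Lemma82.beta2, hα, ell]
      norm_num; ring
    · right; right
      simp only [betaJ, Nat.reduceMod, beta3, Lemma82.beta3, hα, ell]
      norm_num; ring
  have hβμ : betaMu D μ ∈ ({betaMain (3 / 2) (π / Real.log D ^ 9),
      betaMain (5 / 2) (π / Real.log D ^ 9)} : Set ℂ) := by
    simp only [Finset.mem_insert, Finset.mem_singleton] at hμ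
    simp only [Set.mem_insert_iff, Set.mem_singleton_iff]
    rcases hμ with rfl | rfl
    · left
      simp only [betaMu, beta6, betaMain, hα]
      norm_num; ring
    · right
      simp only [betaMu, if_true, beta7, betaMain, hα]
      push_cast; ring
  have hy1 : Real.exp (Real.log D ^ (11 / 10 : ℝ)) ≤ y := by
    have : bigT D = Real.exp (Real.log D ^ (11 / 10 : ℝ)) := by rw [bigT, ell]; norm_num
    rw [← this]; exact hTy.le
  have hy2 : y ≤ Real.exp (Real.log D ^ 9) := by
    have : bigP D = Real.exp (Real.log D ^ 9) := by rw [bigP, ell]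
    rw [← this]; exact hyP.le
  have hy0 : 0 < y := lt_of_lt_of_le (Real.exp_pos _) hy1
  have key := h D χ hp hL3 hA' hL8 (betaJ c' D j) hβj (betaMu D μ) hβμ y hy1 hy2
  rw [frakfW, sum82_eq χ _ _ hy0, ← div_eq_mul_inv]
  exact key

/-- **Lemma 8.3** (§8 p. 17, proved in Appendix A): for `dr < PT⁻²`, "the function
`𝔲_j(d,r;s) = L(s,χ)/(L(s+β_{j+1},χ)L(s+β_{j+2},χ)) · Σ_nχ(n)ξ₀ⱼ(n;d,r)n^{−s}` is analytic and it
satisfies `|𝔲_j(d,r;s)| < c∏_{q∣dr}(1 + cq^{−σ})` for `σ > 9/10`. Further, if `|s − 1| ≤ 5α`, then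
`𝔲_j(d,r;s) = Π(d,r) + O(𝓛⁻⁸)`" — typed as the existence of such an analytic continuation `U` of
the product from `σ > 1` to `σ > 9/10`. CLAIM. [cite: Zhang2022LandauSiegel, §8 Lemma 8.3] -/
def Lemma83 : Prop :=
  ∃ C : ℝ, ForAllLarge fun D _ χ => AssumptionA D χ →
    ∀ j ∈ ({1, 2, 3} : Finset ℕ), ∀ d r : ℕ, 1 ≤ d → 1 ≤ r → ((d * r : ℕ) : ℝ) < bigP D / bigT D ^ 2 →
      ∃ U : ℂ → ℂ, DifferentiableOn ℂ U {s : ℂ | 9 / 10 < s.re} ∧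
        (∀ s : ℂ, 1 < s.re → U s = χ.LFunction s /
            (χ.LFunction (s + betaJ c' D (j + 1)) * χ.LFunction (s + betaJ c' D (j + 2))) *
              xiSeries c' χ j d r s) ∧
        (∀ s : ℂ, 9 / 10 < s.re →
          ‖U s‖ ≤ C * ∏ q ∈ (d * r).primeFactors, (1 + C * (q : ℝ) ^ (-s.re))) ∧
        (∀ s : ℂ, ‖s - 1‖ ≤ 5 * alpha D → ‖U s - PiW χ d r‖ ≤ C * (ell D ^ 8)⁻¹)

/-- **Lemma 8.4** (§8 p. 17, under (A)): "Suppose `dr < PT⁻²` and `T < x < P`. Then for `μ = 6, 7`,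
`Σ_{n<x} χ(n)ξ₀ⱼ(n;d,r)n⁻¹(x/n)^{−β_μ}log(x/n) = L′(1,χ)Π(d,r)𝔤_{jμ}(x) + O(𝓛⁻⁶)`." CLAIM.
[cite: Zhang2022LandauSiegel, §8 Lemma 8.4] -/
def Lemma84 : Prop :=
  ∃ C : ℝ, ForAllLarge fun D _ χ => AssumptionA D χ →
    ∀ j ∈ ({1, 2, 3} : Finset ℕ), ∀ μ ∈ ({6, 7} : Finset ℕ), ∀ d r : ℕ, 1 ≤ d → 1 ≤ r →
      ((d * r : ℕ) : ℝ) < bigP D / bigT D ^ 2 → ∀ y : ℝ, bigT D < y → y < bigP D →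
        ‖(∑ n ∈ Finset.Ico 1 ⌈y⌉₊, χ (n : ZMod D) * xiZero c' D j n d r / (n : ℂ) *
              ((y / n : ℝ) : ℂ) ^ (-betaMu D μ) * (Real.log (y / n) : ℂ)) -
            deriv χ.LFunction 1 * PiW χ d r * frakgW c' D j μ y‖ ≤ C * (ell D ^ 6)⁻¹

/-! ## Lemmas 10.1–10.2 -/

/-- **Lemma 10.1** (§10 p. 20), the four ranges (10.2)–(10.5) for `𝔳₁ⱼ(y)` (`T^{−c}` with some
absolute `c > 0`). CLAIM. [cite: Zhang2022LandauSiegel, §10 Lemma 10.1] -/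
def Lemma101 : Prop :=
  ∃ c : ℝ, 0 < c ∧ ∃ C : ℝ, ForAllLarge fun D _ χ => AssumptionA D χ →
    ∀ j ∈ ({1, 2, 3} : Finset ℕ), ∀ y : ℝ,
      (1 ≤ y → y ≤ bigP D ^ (0.5 : ℝ) / bigT D → ‖frakv1 c' χ j y‖ ≤ C * bigT D ^ (-c)) ∧
      (bigP D ^ (0.5 : ℝ) < y → y ≤ bigP D ^ (0.502 : ℝ) / bigT D →
        ‖frakv1 c' χ j y - 500 * deriv χ.LFunction 1 / Real.log (bigP D) *
          (-1 - betaJ c' D j * (Real.log (y / bigP D ^ (0.5 : ℝ)) : ℂ))‖ ≤ C * (ell D ^ 15)⁻¹) ∧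
      (bigP D ^ (0.502 : ℝ) < y → y ≤ bigP D ^ (0.504 : ℝ) / bigT D →
        ‖frakv1 c' χ j y - 500 * deriv χ.LFunction 1 / Real.log (bigP D) *
          (1 - betaJ c' D j * (Real.log (bigP D ^ (0.504 : ℝ) / y) : ℂ))‖ ≤ C * (ell D ^ 15)⁻¹) ∧
      ((bigP D ^ (0.5 : ℝ) / bigT D < y ∧ y ≤ bigP D ^ (0.5 : ℝ)) ∨
          (bigP D ^ (0.502 : ℝ) / bigT D < y ∧ y ≤ bigP D ^ (0.502 : ℝ)) ∨
          (bigP D ^ (0.504 : ℝ) / bigT D < y ∧ y < bigP D ^ (0.504 : ℝ)) →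
        ‖frakv1 c' χ j y‖ ≤ C * (ell D ^ 7)⁻¹)

/-- **Lemma 10.2** (§10 pp. 20–21), the four ranges (10.8)–(10.11) for `𝔳₂ⱼ(d,r)`. CLAIM.
[cite: Zhang2022LandauSiegel, §10 Lemma 10.2] -/
def Lemma102 : Prop :=
  ∃ C : ℝ, ForAllLarge fun D _ χ => AssumptionA D χ →
    ∀ j ∈ ({1, 2, 3} : Finset ℕ), ∀ d r : ℕ, 1 ≤ d → 1 ≤ r →
      (((d * r : ℕ) : ℝ) ≤ bigP D ^ (0.5 : ℝ) / bigT D →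
        ‖frakv2 c' χ j d r - deriv χ.LFunction 1 * PiW χ d r / 500 *
          (betaJ c' D (j + 1) * betaJ c' D (j + 2)) * Real.log (bigP D)‖ ≤ C * (ell D ^ 15)⁻¹) ∧
      (bigP D ^ (0.5 : ℝ) < ((d * r : ℕ) : ℝ) → ((d * r : ℕ) : ℝ) ≤ bigP D ^ (0.502 : ℝ) / bigT D →
        ‖frakv2 c' χ j d r - 500 * deriv χ.LFunction 1 * PiW χ d r / Real.log (bigP D) *
          (-1 + fraky1 c' D j ((d * r : ℕ) : ℝ))‖ ≤ C * (ell D ^ 15)⁻¹) ∧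
      (bigP D ^ (0.502 : ℝ) < ((d * r : ℕ) : ℝ) →
        ((d * r : ℕ) : ℝ) ≤ bigP D ^ (0.504 : ℝ) / bigT D →
        ‖frakv2 c' χ j d r - 500 * deriv χ.LFunction 1 * PiW χ d r / Real.log (bigP D) *
          (1 + fraky2 c' D j ((d * r : ℕ) : ℝ))‖ ≤ C * (ell D ^ 15)⁻¹) ∧
      ((bigP D ^ (0.5 : ℝ) / bigT D < ((d * r : ℕ) : ℝ) ∧ ((d * r : ℕ) : ℝ) ≤ bigP D ^ (0.5 : ℝ)) ∨
          (bigP D ^ (0.502 : ℝ) / bigT D < ((d * r : ℕ) : ℝ) ∧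
            ((d * r : ℕ) : ℝ) ≤ bigP D ^ (0.502 : ℝ)) ∨
          (bigP D ^ (0.504 : ℝ) / bigT D < ((d * r : ℕ) : ℝ) ∧
            ((d * r : ℕ) : ℝ) < bigP D ^ (0.504 : ℝ)) →
        ‖frakv2 c' χ j d r‖ ≤ C * (ell D ^ 7)⁻¹)

/-! ## Lemmas 11.1–11.2 -/

/-- **Lemma 11.1** (§11 p. 23): (11.2) "if
`y ∈ [P^{0.5}η₊, P^{0.502}η₋] ∪ [P^{0.502}η₊, P^{0.504}η₋]` then `f̃(log y/log P) − g̃₁(y) ≪ ε`"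
(`ε = exp{−c𝓛¹⁰}`); (11.3) on the three windows `(P^{a}η₋, P^{a}η₊)`, `a ∈ {0.5, 0.502, 0.504}`,
"`f̃(log y/log P) − g̃₁(y) ≪ 𝓛⁻¹⁰`". CLAIM. [cite: Zhang2022LandauSiegel, §11 Lemma 11.1] -/
def Lemma111 : Prop :=
  ∃ c : ℝ, 0 < c ∧ ∃ C : ℝ, ForAllLarge fun D _ _ => ∀ y : ℝ,
    ((bigP D ^ (0.5 : ℝ) * etaPM D 1 ≤ y ∧ y ≤ bigP D ^ (0.502 : ℝ) * etaPM D (-1)) ∨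
        (bigP D ^ (0.502 : ℝ) * etaPM D 1 ≤ y ∧ y ≤ bigP D ^ (0.504 : ℝ) * etaPM D (-1)) →
      |ftilde (Real.log y / Real.log (bigP D)) - gtilde1 D y| ≤ C * Real.exp (-c * ell D ^ 10)) ∧
    ((∃ a ∈ ({0.5, 0.502, 0.504} : Finset ℝ),
        bigP D ^ a * etaPM D (-1) < y ∧ y < bigP D ^ a * etaPM D 1) →
      |ftilde (Real.log y / Real.log (bigP D)) - gtilde1 D y| ≤ C * (ell D ^ 10)⁻¹)

/-- **Lemma 11.2** (§11 p. 23): "Suppose `σ = 1/2` and `|t − 2πt₀| < 𝓛₁`. Then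
`J̃₁(s,ψ) = Z(s,ψχ)J̃₂(1−s,ψ̄) + O(E₂(s,ψ))`" (for `ψ ∈ Ψ`). CLAIM.
[cite: Zhang2022LandauSiegel, §11 Lemma 11.2] -/
def Lemma112 : Prop :=
  ∃ C : ℝ, ForAllLarge fun D _ χ => AssumptionA D χ → ∀ x : Chr D, ∀ s : ℂ, s.re = 1 / 2 →
    |s.im - 2 * π * t0 D| < ell1 D →
      ‖Jtilde1 χ x s - Zpc χ x s * Jtilde2Bar χ x (1 - s)‖ ≤ C * E2main χ x s

/-! ## The section-level computations as named implications, and their modus ponens -/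

/-- **§8 pp. 17–18, (8.9)–(8.22)**: the computation "(8.7) + Proposition 7.1 + Lemmas 8.2–8.4 (+
(8.10) 'by verifying the case `n = q^k`', (8.11) partial integration with [T, 1.2.12], (8.12) change
of variables, the approximations `𝔣_{jμ}(P^z) = 𝔣𝔣_{jμ}(z) + O(𝓛⁻⁸)` (8.13)–(8.18), the closed
forms (8.19)–(8.22)) ⇒ (8.23)", as ONE named implication (its internal algebra is kernel-checked in
the tree's `Section8MainTerms`, `Section8ChangeOfVariables`, `Section8ClosedForm`). CLAIM.
[cite: Zhang2022LandauSiegel, §8 (8.9)–(8.23)] -/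
def Ded823 : Prop := Eq87 c' → Prop71 c' → Lemma82 c' → Lemma83 c' → Lemma84 c' → Eval823 c'

/-- **§9, (9.3)–(9.7)**: "(9.1) + Proposition 7.1 + Lemmas 8.2–8.4 ⇒ (9.7)" ("in a way similar to
the proof of (8.12)"). CLAIM. [cite: Zhang2022LandauSiegel, §9 (9.1)–(9.7)] -/
def Ded97 : Prop := Eq91 c' → Prop71 c' → Lemma82 c' → Lemma83 c' → Lemma84 c' → Eval97 c'

/-- **§10 pp. 20–23, (10.12)–(10.17)**: "(10.1) + Proposition 7.1 + Lemmas 8.2–8.4, 10.1, 10.2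
('and the results in Section 8') ⇒ (10.17)". CLAIM. [cite: Zhang2022LandauSiegel, §10 (10.12)–(10.17)] -/
def Ded1017 : Prop :=
  Eq101 c' → Prop71 c' → Lemma82 c' → Lemma83 c' → Lemma84 c' → Lemma101 c' → Lemma102 c' →
    Eval1017 c'

/-- **§18 pp. 36–37, proof of (2.33)**: "(18.3) + Proposition 7.1 + Lemmas 10.1, 10.2 (three
ranges of `dr`; 'the factors … make minor contribution'; the crude bound `Re S_j < 1100𝔞/log P`)
⇒ `Ξ_J ≤ (8800/π)𝔞𝔓 + o(𝔓)`". CLAIM. [cite: Zhang2022LandauSiegel, §18 pp. 36–37] -/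
def Ded183 : Prop := Eq183 c' → Prop71 c' → Lemma101 c' → Lemma102 c' → Bound183 c'

/-- **§11 p. 23, (11.5)–(11.6)**: "Lemmas 11.1, 11.2 + the discrete mean-value bounds cited as
'(8.25), (8.26)' (NO SUCH DISPLAYS EXIST in v1 — §8 ends at (8.24); read: Lemma 8.1 + Proposition
7.1 used as upper bounds) ⇒ (11.1)". CLAIM. [cite: Zhang2022LandauSiegel, §11 (11.1)–(11.6)] -/
def Ded111 : Prop := Lemma111 → Lemma112 → Lemma81 c' → Prop71 c' → Eval111 c'

/-- (8.23) from its named inputs and the §8 computation. [cite: Zhang2022LandauSiegel, §8 (8.23)] -/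
theorem eval823_of (h87 : Eq87 c') (h71 : Prop71 c') (h82 : Lemma82 c') (h83 : Lemma83 c')
    (h84 : Lemma84 c') (hded : Ded823 c') : Eval823 c' :=
  hded h87 h71 h82 h83 h84

/-- (9.7) from its named inputs and the §9 computation. [cite: Zhang2022LandauSiegel, §9 (9.7)] -/
theorem eval97_of (h91 : Eq91 c') (h71 : Prop71 c') (h82 : Lemma82 c') (h83 : Lemma83 c')
    (h84 : Lemma84 c') (hded : Ded97 c') : Eval97 c' :=
  hded h91 h71 h82 h83 h84

/-- (10.17) from its named inputs and the §10 computation. [cite: Zhang2022LandauSiegel, §10 (10.17)] -/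
theorem eval1017_of (h101 : Eq101 c') (h71 : Prop71 c') (h82 : Lemma82 c') (h83 : Lemma83 c')
    (h84 : Lemma84 c') (hL101 : Lemma101 c') (hL102 : Lemma102 c') (hded : Ded1017 c') :
    Eval1017 c' :=
  hded h101 h71 h82 h83 h84 hL101 hL102

/-- The bound behind (2.33) from its named inputs and the §18 computation.
[cite: Zhang2022LandauSiegel, §18 (18.3)] -/
theorem bound183_of (h183 : Eq183 c') (h71 : Prop71 c') (hL101 : Lemma101 c')
    (hL102 : Lemma102 c') (hded : Ded183 c') : Bound183 c' :=
  hded h183 h71 hL101 hL102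

/-- (11.1) from its named inputs and the §11 computation. [cite: Zhang2022LandauSiegel, §11 (11.1)] -/
theorem eval111_of (h111 : Lemma111) (h112 : Lemma112) (h81 : Lemma81 c') (h71 : Prop71 c')
    (hded : Ded111 c') : Eval111 c' :=
  hded h111 h112 h81 h71

end Lemmas

end Literature.NumberTheory.LFunctions.Zhang2022.Skeleton
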